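import Mathlib
import HarnessLib
import Literature.Barriers.QuantumAdvantage.DegreeOnePrimesEscapeNeedsProperness

/-!
# DegreeOnePrimesEscapeWithoutProper — MOVED (deprecated alias module)

Topic `Literature/Uncategorized`. Every declaration of this gate-parked module now lives,
byte-identical, in `Literature/Barriers/QuantumAdvantage/DegreeOnePrimesEscapeNeedsProperness.lean`
(namespace `Literature.Barriers.QuantumAdvantage`; librarian move 2026-08-16). This module keeps the
main constant as a deprecated reducible `abbrev` of the moved one and every other name as a
deprecated alias, so that importers keep compiling (deprecation warnings only); it can be deleted
once no module names `Literature.Uncategorized.DegreeOnePrimesEscapeWithoutProper`.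
-/

namespace Literature.Uncategorized

/-- DEPRECATED alias (librarian move 2026-08-16): this constant is, by definition, the moved
`Literature.Barriers.QuantumAdvantage.DegreeOnePrimesEscapeWithoutProper`
(statement byte-identical there); kept as a reducible `abbrev` so that files naming the old
constant keep elaborating. [folklore] -/
@[deprecated Literature.Barriers.QuantumAdvantage.DegreeOnePrimesEscapeWithoutProper
  (since := "2026-08-16")]
abbrev DegreeOnePrimesEscapeWithoutProper : Prop :=
  Literature.Barriers.QuantumAdvantage.DegreeOnePrimesEscapeWithoutProper

@[deprecated Literature.Barriers.QuantumAdvantage.DegreeOnePrimesEscapeWithoutProper_false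
  (since := "2026-08-16")]
alias DegreeOnePrimesEscapeWithoutProper_false :=
  Literature.Barriers.QuantumAdvantage.DegreeOnePrimesEscapeWithoutProper_false

@[deprecated Literature.Barriers.QuantumAdvantage.DegreeOnePrimesEscapeWithoutProper_iff_false
  (since := "2026-08-16")]
alias DegreeOnePrimesEscapeWithoutProper_iff_false :=
  Literature.Barriers.QuantumAdvantage.DegreeOnePrimesEscapeWithoutProper_iff_false

end Literature.Uncategorized
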